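import Summits.QuantumFields.YangMills.Theorems.LuscherReductionOneSiteLevelsGnPotDerivH

/-!
# The quasimode trial space: cut-off spans of eigenfunctions, their pull-backs, decay moments
# (support module for the registered stub `stub_absLower` of crux `OneSiteLevels`, route `LuscherReduction`,
# item stmt-QuantumFields-20007; fleet seat prover ym-luscher-20007-p2)

For a family `f : Fin (k+1) → ZM → ℝ` (the eigenfunctions of the named fact `LuscherHamiltonianEigenfunctions k`) and a cut-off
radius `R`, the trial functions on `ℝ⁹` are `cutSpan f R a = radialCutoff R · Σ_j a_j f_j`, and the trial states of the one-site
transfer operator are their gnomonic pull-backs `trialMap f R μ a = cutSpan f R a ∘ gnCoord μ` — LINEAR in `a`.  Proved here: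
linearity, the support radius `√2·R`, and — from a uniform decay bound `|f_j| ≤ C_f e^{−‖x‖}` — the polynomial moments
`∫ ‖y‖^m (cutSpan f R a)² ≤ m! · ((k+1) C_f² ∫e^{−‖y‖}) · Σ_j a_j²` (`integral_pow_mul_cutSpan_sq_le`), together with the
polynomial bound `gnLip² ≤ μ²(108‖y‖² + 972‖y‖⁶ + 27‖y‖¹⁰)` (`gnLip_sq_le`) valid for `Bμ³ = 1/4`, `μ ≤ 1/2`.

## WHAT THIS IS NOT
Bookkeeping; NOT the stub, NOT THE CLAY GAP.  Sorry-free, no named fact.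
-/

set_option autoImplicit false

noncomputable section

open MeasureTheory Filter Topology Real
open scoped Matrix ENNReal
open Literature.MathematicalPhysics.QuantumFieldTheory
open Literature.MathematicalPhysics.QuantumLattice
open Literature.Analysis.OperatorTheory.YMMatrixModel

namespace Summit.QuantumFields.YangMills.Theorems.FemtoTransferGap

section Trial

variable {k : ℕ} (f : Fin (k + 1) → ZM → ℝ)

/-- The span `F_a = Σ_j a_j f_j`. [folklore] -/
def spanFn (a : Fin (k + 1) → ℝ) : ZM → ℝ := fun x => ∑ j, a j * f j x

/-- The cut-off span `G_a = χ_R · F_a`. [folklore] -/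
def cutSpan (R : ℝ) (a : Fin (k + 1) → ℝ) : ZM → ℝ := radialCutoff R * spanFn f a

/-- `cutSpan` unfolded at a point. [folklore] -/
theorem cutSpan_apply (R : ℝ) (a : Fin (k + 1) → ℝ) (x : ZM) : cutSpan f R a x = radialCutoff R x * ∑ j, a j * f j x := rfl

/-- `cutSpan` is the product in the form used by `quasimode_estimate`. [folklore] -/
theorem cutSpan_eq (R : ℝ) (a : Fin (k + 1) → ℝ) : cutSpan f R a = radialCutoff R * fun x => ∑ j, a j * f j x := rfl

/-- Additivity in the coefficients. [folklore] -/
theorem cutSpan_add (R : ℝ) (a b : Fin (k + 1) → ℝ) : cutSpan f R (a + b) = cutSpan f R a + cutSpan f R b := by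
  funext x
  simp only [cutSpan_apply, Pi.add_apply, add_mul, Finset.sum_add_distrib, mul_add]

/-- Homogeneity in the coefficients. [folklore] -/
theorem cutSpan_smul (R t : ℝ) (a : Fin (k + 1) → ℝ) : cutSpan f R (t • a) = t • cutSpan f R a := by
  funext x
  simp only [cutSpan_apply, Pi.smul_apply, smul_eq_mul, mul_assoc, ← Finset.mul_sum]
  ring

/-- **The trial states**, linear in the coefficients: `a ↦ (U ↦ G_a(gnCoord μ U))`. [folklore] -/
def trialMap (R μ : ℝ) : (Fin (k + 1) → ℝ) →ₗ[ℝ] (Cfg → ℝ) where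
  toFun a := fun U => cutSpan f R a (gnCoord μ U)
  map_add' a b := by funext U; simp [cutSpan_add]
  map_smul' t a := by funext U; simp [cutSpan_smul]

/-- `trialMap` applied. [folklore] -/
@[simp] theorem trialMap_apply (R μ : ℝ) (a : Fin (k + 1) → ℝ) (U : Cfg) : trialMap f R μ a U = cutSpan f R a (gnCoord μ U) := rfl

/-- **Support radius**: `G_a` vanishes outside `‖y‖ ≤ √2·R` (`R > 0`). [folklore] -/
theorem norm_le_of_cutSpan_ne_zero {R : ℝ} (hR : 0 < R) (a : Fin (k + 1) → ℝ) {y : ZM} (hy : cutSpan f R a y ≠ 0) :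
    ‖y‖ ≤ Real.sqrt 2 * R := by
  by_contra h
  have h : Real.sqrt 2 * R < ‖y‖ := lt_of_not_ge h
  have h2 : 2 * R ^ 2 ≤ ‖y‖ ^ 2 := by
    have hs : (Real.sqrt 2 * R) ^ 2 = 2 * R ^ 2 := by rw [mul_pow, Real.sq_sqrt (by norm_num)]
    rw [← hs]
    exact pow_le_pow_left₀ (by positivity) h.le 2
  exact hy (by rw [cutSpan_apply, radialCutoff_eq_zero hR h2, zero_mul])

/-- The window condition at scale `μ`: `μ² (√2 R)² = 2μ²R²`. [folklore] -/
theorem sq_sqrt_two_mul (μ R : ℝ) : μ ^ 2 * (Real.sqrt 2 * R) ^ 2 = 2 * (μ * R) ^ 2 := by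
  rw [mul_pow, Real.sq_sqrt (by norm_num)]; ring

variable {f}

/-- Pointwise decay of the span: `|F_a(x)| ≤ (Σ|a_j|) C_f e^{−‖x‖}`. [folklore] -/
theorem abs_spanFn_le {Cf : ℝ} (hCf : ∀ j x, |f j x| ≤ Cf * Real.exp (-‖x‖)) (a : Fin (k + 1) → ℝ) (x : ZM) :
    |spanFn f a x| ≤ (∑ j, |a j|) * (Cf * Real.exp (-‖x‖)) := by
  unfold spanFn
  rw [Finset.sum_mul]
  refine (Finset.abs_sum_le_sum_abs _ _).trans (Finset.sum_le_sum fun j _ => ?_)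
  rw [abs_mul]
  exact mul_le_mul_of_nonneg_left (hCf j x) (abs_nonneg _)

/-- `(Σ|a_j|)² ≤ (k+1) Σ a_j²`. [folklore] -/
theorem sq_sum_abs_le (a : Fin (k + 1) → ℝ) : (∑ j, |a j|) ^ 2 ≤ (k + 1) * ∑ j, a j ^ 2 := by
  have h := sq_sum_le_card_mul_sum_sq (s := (Finset.univ : Finset (Fin (k + 1)))) (f := fun j => |a j|)
  simp only [Finset.card_univ, Fintype.card_fin, sq_abs] at h
  exact_mod_cast h

/-- **Pointwise decay of the cut-off span squared**: `G_a(x)² ≤ (k+1) C_f² (Σa_j²) e^{−2‖x‖}`. [folklore] -/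
theorem cutSpan_sq_le {Cf : ℝ} (hCf : ∀ j x, |f j x| ≤ Cf * Real.exp (-‖x‖)) (R : ℝ) (a : Fin (k + 1) → ℝ) (x : ZM) :
    cutSpan f R a x ^ 2 ≤ (k + 1) * Cf ^ 2 * (∑ j, a j ^ 2) * Real.exp (-‖x‖) ^ 2 := by
  rw [cutSpan_apply]
  have hχ := radialCutoff_mem_Icc R x
  have h1 : (radialCutoff R x * ∑ j, a j * f j x) ^ 2 ≤ (∑ j, a j * f j x) ^ 2 := by
    rw [mul_pow]
    have : radialCutoff R x ^ 2 ≤ 1 := by nlinarith [hχ.1, hχ.2]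
    nlinarith [sq_nonneg (∑ j, a j * f j x)]
  have h2 : (∑ j, a j * f j x) ^ 2 ≤ ((∑ j, |a j|) * (Cf * Real.exp (-‖x‖))) ^ 2 := by
    have h := abs_spanFn_le hCf a x
    rw [spanFn] at h
    rw [← sq_abs]
    exact pow_le_pow_left₀ (abs_nonneg _) h 2
  have h3 : ((∑ j, |a j|) * (Cf * Real.exp (-‖x‖))) ^ 2 ≤ (k + 1) * Cf ^ 2 * (∑ j, a j ^ 2) * Real.exp (-‖x‖) ^ 2 := by
    rw [mul_pow, mul_pow]
    have := sq_sum_abs_le a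
    have h0 : 0 ≤ Cf ^ 2 * Real.exp (-‖x‖) ^ 2 := by positivity
    nlinarith
  linarith

/-- `‖x‖^m e^{−‖x‖} ≤ m!`. [folklore] -/
theorem pow_mul_exp_neg_norm_le (m : ℕ) (x : ZM) : ‖x‖ ^ m * Real.exp (-‖x‖) ≤ (m.factorial : ℝ) := by
  have h := Real.pow_div_factorial_le_exp ‖x‖ (norm_nonneg x) m
  have hm : (0 : ℝ) < m.factorial := by exact_mod_cast Nat.factorial_pos m
  rw [div_le_iff₀ hm] at h
  rw [Real.exp_neg]
  have he := Real.exp_pos ‖x‖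
  rw [mul_inv_le_iff₀ he]
  linarith

/-- **Polynomial moments of the cut-off span**: `∫ ‖y‖^m G_a² ≤ m! · (k+1) C_f² (∫e^{−‖y‖}) · Σ a_j²`. [folklore] -/
theorem integral_pow_mul_cutSpan_sq_le {Cf : ℝ} (hCf : ∀ j x, |f j x| ≤ Cf * Real.exp (-‖x‖))
    (R : ℝ) (a : Fin (k + 1) → ℝ) (m : ℕ) :
    ∫ y, ‖y‖ ^ m * cutSpan f R a y ^ 2 ≤
      (m.factorial : ℝ) * ((k + 1) * Cf ^ 2 * ∫ y : ZM, Real.exp (-‖y‖)) * ∑ j, a j ^ 2 := by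
  have hint : Integrable fun y : ZM => (m.factorial : ℝ) * ((k + 1) * Cf ^ 2 * ∑ j, a j ^ 2) * Real.exp (-‖y‖) :=
    (integrable_exp_neg_norm).const_mul _
  have hpt : ∀ y : ZM, ‖y‖ ^ m * cutSpan f R a y ^ 2 ≤ (m.factorial : ℝ) * ((k + 1) * Cf ^ 2 * ∑ j, a j ^ 2) * Real.exp (-‖y‖) := by
    intro y
    have h1 := cutSpan_sq_le hCf R a y
    have h2 := pow_mul_exp_neg_norm_le m y
    have hA : 0 ≤ (k + 1) * Cf ^ 2 * (∑ j, a j ^ 2) := by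
      have : 0 ≤ ∑ j, a j ^ 2 := Finset.sum_nonneg fun j _ => sq_nonneg _
      positivity
    calc ‖y‖ ^ m * cutSpan f R a y ^ 2 ≤ ‖y‖ ^ m * ((k + 1) * Cf ^ 2 * (∑ j, a j ^ 2) * Real.exp (-‖y‖) ^ 2) :=
          mul_le_mul_of_nonneg_left h1 (by positivity)
      _ = (‖y‖ ^ m * Real.exp (-‖y‖)) * ((k + 1) * Cf ^ 2 * (∑ j, a j ^ 2)) * Real.exp (-‖y‖) := by ring
      _ ≤ (m.factorial : ℝ) * ((k + 1) * Cf ^ 2 * (∑ j, a j ^ 2)) * Real.exp (-‖y‖) := by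
          gcongr
  calc ∫ y, ‖y‖ ^ m * cutSpan f R a y ^ 2 ≤ ∫ y : ZM, (m.factorial : ℝ) * ((k + 1) * Cf ^ 2 * ∑ j, a j ^ 2) * Real.exp (-‖y‖) :=
        integral_mono_of_nonneg (ae_of_all _ fun y => by positivity) hint (ae_of_all _ hpt)
    _ = (m.factorial : ℝ) * ((k + 1) * Cf ^ 2 * ∫ y : ZM, Real.exp (-‖y‖)) * ∑ j, a j ^ 2 := by
        rw [integral_const_mul]; ring

/-- **The gradient-size function is `O(μ)`**: for `Bμ³ = 1/4`, `0 < μ ≤ 1/2`,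
`gnLip B μ y ² ≤ μ² (108‖y‖² + 972‖y‖⁶ + 27‖y‖¹⁰)`. [folklore] -/
theorem gnLip_sq_le {B μ : ℝ} (hμ : 0 < μ) (hμ1 : μ ≤ 1 / 2) (hBμ : B * μ ^ 3 = 1 / 4) (y : ZM) :
    gnLip B μ y ^ 2 ≤ μ ^ 2 * (108 * ‖y‖ ^ 2 + 972 * ‖y‖ ^ 6 + 27 * ‖y‖ ^ 10) := by
  have hn := norm_nonneg y
  have e : gnLip B μ y = μ * (12 * μ * ‖y‖ + 9 * (μ ^ 2 * ‖y‖ ^ 5 + 2 * ‖y‖ ^ 3)) := by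
    unfold gnLip
    have : 36 * B * μ ^ 4 = 9 * μ := by nlinarith [hBμ]
    calc 12 * μ ^ 2 * ‖y‖ + 36 * B * μ ^ 4 * (μ ^ 2 * ‖y‖ ^ 5 + 2 * ‖y‖ ^ 3)
        = 12 * μ ^ 2 * ‖y‖ + (36 * B * μ ^ 4) * (μ ^ 2 * ‖y‖ ^ 5 + 2 * ‖y‖ ^ 3) := by ring
      _ = μ * (12 * μ * ‖y‖ + 9 * (μ ^ 2 * ‖y‖ ^ 5 + 2 * ‖y‖ ^ 3)) := by rw [this]; ring
  rw [e, mul_pow]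
  refine mul_le_mul_of_nonneg_left ?_ (sq_nonneg μ)
  -- inner ≤ 6‖y‖ + 3‖y‖⁵ + 18‖y‖³ and (a+b+c)² ≤ 3(a²+b²+c²)
  have h1 : 12 * μ * ‖y‖ ≤ 6 * ‖y‖ := by nlinarith
  have h2 : 9 * (μ ^ 2 * ‖y‖ ^ 5) ≤ 3 * ‖y‖ ^ 5 := by
    have : μ ^ 2 ≤ 1 / 4 := by nlinarith
    nlinarith [pow_nonneg hn 5]
  have hinner : 12 * μ * ‖y‖ + 9 * (μ ^ 2 * ‖y‖ ^ 5 + 2 * ‖y‖ ^ 3) ≤ 6 * ‖y‖ + 18 * ‖y‖ ^ 3 + 3 * ‖y‖ ^ 5 := by nlinarith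
  have hinner0 : 0 ≤ 12 * μ * ‖y‖ + 9 * (μ ^ 2 * ‖y‖ ^ 5 + 2 * ‖y‖ ^ 3) := by positivity
  calc (12 * μ * ‖y‖ + 9 * (μ ^ 2 * ‖y‖ ^ 5 + 2 * ‖y‖ ^ 3)) ^ 2 ≤ (6 * ‖y‖ + 18 * ‖y‖ ^ 3 + 3 * ‖y‖ ^ 5) ^ 2 :=
        pow_le_pow_left₀ hinner0 hinner 2
    _ ≤ 3 * ((6 * ‖y‖) ^ 2 + (18 * ‖y‖ ^ 3) ^ 2 + (3 * ‖y‖ ^ 5) ^ 2) := by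
        nlinarith [sq_nonneg (6 * ‖y‖ - 18 * ‖y‖ ^ 3), sq_nonneg (6 * ‖y‖ - 3 * ‖y‖ ^ 5), sq_nonneg (18 * ‖y‖ ^ 3 - 3 * ‖y‖ ^ 5)]
    _ = 108 * ‖y‖ ^ 2 + 972 * ‖y‖ ^ 6 + 27 * ‖y‖ ^ 10 := by ring

end Trial

end Summit.QuantumFields.YangMills.Theorems.FemtoTransferGap

end
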